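import Summits.FinalStateConjecture.FinalStateConjecture.Theorems.EIHFluxBalanceInertialRecessionChargeKinematicsBasic
import Mathlib.Analysis.InnerProductSpace.Calculus

/-!
# Route EIHFluxBalance — `InertialRecession`, line `old-light-leaves-the-cone`: charge kinematics,
# IV (the singleton law; increment algebra)

Helper file for the crux `stmt-FinalStateConjecture-10166`
(`Summit.FinalStateConjecture.FinalStateConjecture.Theses.EIHFluxBalance.InertialRecession`), second line
lead, endgame stub `stub_expandingChargeKinematics` (S4: abstract quasi-conserved window charges with the
slack-form window law and the single-hole identification ⇒ Cesàro velocities of the painted centres).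

IV — THE SINGLETON LAW (`singleton_law`): along the anchored nearest-neighbour window of ONE hole — any
radius function which is eventually `2`-Lipschitz, below the cone rate, keeps every other centre `≥ 3R`
away and tends to `+∞` — the charge changes by at most `C∫(R⁻² + R^{-7/4}) + e(t₁)` on EVERY late interval
with ONE slack (singleton windows never die: this is what makes the `N ≤ 2` endgame event-free), and is
`Mᵢγᵢ(1, vᵢ)` up to `e(t) → 0`. Plus the algebra of charge increments (`norm_sub_le_of_gamma`: velocity
increments from four-momentum increments) and small order/calculus lemmas used by the pair analysis.

Every statement is Mathlib-only real analysis over the stub's verbatim hypotheses ([folklore]); the abstract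
charge `P` is arbitrary (adversarial), constrained only by the window law and the identification.
-/

set_option linter.dupNamespace false

noncomputable section

open Filter Set Metric Real
open scoped Topology

namespace Summit.FinalStateConjecture.FinalStateConjecture.Theorems.ChargeKinematics

open Literature.Geometry.Lorentzian

/-! ## The singleton law: one slack along the nearest-neighbour window, however long the interval -/

section Singleton

open MeasureTheory intervalIntegral

/-- Lipschitz bookkeeping for a finite infimum: if `|f j − g j| ≤ c` for all `j ∈ S` then
`|inf' f − inf' g| ≤ c`. [folklore] -/
theorem abs_inf'_sub_inf'_le {ι : Type*} {S : Finset ι} (hS : S.Nonempty) {f g : ι → ℝ} {c : ℝ}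
    (h : ∀ j ∈ S, |f j - g j| ≤ c) : |S.inf' hS f - S.inf' hS g| ≤ c := by
  obtain ⟨jf, hjf, hf⟩ := Finset.exists_mem_eq_inf' hS f
  obtain ⟨jg, hjg, hg⟩ := Finset.exists_mem_eq_inf' hS g
  rw [abs_sub_le_iff]
  constructor
  · -- `inf f - inf g ≤ c`: `inf f ≤ f jg ≤ g jg + c = inf g + c`
    have h1 : S.inf' hS f ≤ f jg := Finset.inf'_le f hjg
    have h2 := (abs_sub_le_iff.mp (h jg hjg)).1
    linarith
  · have h1 : S.inf' hS g ≤ g jf := Finset.inf'_le g hjf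
    have h2 := (abs_sub_le_iff.mp (h jf hjf)).2
    linarith

/-- A finite infimum of functions tending to `+∞` tends to `+∞`. [folklore] -/
theorem tendsto_inf'_atTop {ι : Type*} {S : Finset ι} (hS : S.Nonempty) {f : ι → ℝ → ℝ}
    (h : ∀ j ∈ S, Tendsto (f j) atTop atTop) :
    Tendsto (fun s ↦ S.inf' hS fun j ↦ f j s) atTop atTop := by
  rw [Filter.tendsto_atTop]
  intro b
  have : ∀ᶠ s in atTop, ∀ j ∈ S, b ≤ f j s := by
    rw [show (∀ᶠ s in atTop, ∀ j ∈ S, b ≤ f j s) ↔ ∀ j ∈ S, ∀ᶠ s in atTop, b ≤ f j s from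
      Finset.eventually_all S]
    exact fun j hj ↦ (Filter.tendsto_atTop.mp (h j hj)) b
  exact this.mono fun s hs ↦ Finset.le_inf' hS _ hs

/-- **THE SINGLETON LAW.** Under the window law (slack form, used at `δ = 1/2`) and the single-hole
identification of `stub_expandingChargeKinematics`, fix a hole `i` and ANY radius function `R` which,
after some time `T_R`, is `2`-Lipschitz, stays below the cone rate (`R ≤ (κ−κ²)s/2`), keeps every other
centre at distance `≥ 3R` and tends to `+∞` (the nearest-neighbour choice `R = min(Dᵢ/3, (κ−κ²)s/2)` is
such a function). Then, with ONE constant `C ≥ 0`, ONE threshold `T` and ONE error `e → 0`: along the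
anchored path `(ξᵢ(s), R(s))` the charge changes by at most `C∫(R⁻² + R^{-7/4}) + e(t₁)` on EVERY late
interval `[t₁, t₂]` (one slack, however long the interval — singleton windows never die), and at every
late time the charge is `Mᵢγᵢ(1, vᵢ)` up to `e(t)`. [folklore] -/
theorem singleton_law {N : ℕ} {M : Fin N → ℝ} {ξ v : Fin N → ℝ → E3} {κ : ℝ}
    {P : ℝ → E3 → ℝ → Fin 4 → ℝ} (hκ0 : 0 < κ) (hκ1 : κ < 1)
    (hξ : ∀ i, ContDiff ℝ ((⊤ : ℕ∞) : WithTop ℕ∞) (ξ i))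
    (hcone : ∀ i, ∀ᶠ t in atTop, ‖ξ i t‖ ≤ κ ^ 2 * t)
    (hk : ∃ k : ℝ, 0 ≤ k ∧ k < 1 ∧ ∀ i, ∀ᶠ t in atTop, ‖v i t‖ ≤ k)
    (hslave : ∀ i, Tendsto (fun t ↦ deriv (ξ i) t - v i t) atTop (𝓝 0))
    (hW : ∀ δ : ℝ, 0 < δ → δ < 1 → ∃ (C R₀ T : ℝ) (η : ℝ → ℝ), Tendsto η atTop (𝓝 0) ∧ ∀ (t₁ t₂ : ℝ) (c : ℝ → E3) (R : ℝ → ℝ), T ≤ t₁ → t₁ ≤ t₂ → (∀ s ∈ Set.Icc t₁ t₂, ∀ s' ∈ Set.Icc t₁ t₂, ‖c s - c s'‖ ≤ 2 * |s - s'| ∧ |R s - R s'| ≤ 2 * |s - s'|) → (∀ s ∈ Set.Icc t₁ t₂, (R₀ ≤ R s ∧ ‖c s‖ + R s ≤ (κ + κ ^ 2) / 2 * s ∧ ∀ j, ‖ξ j s - c s‖ ≤ (1 - δ) * R s ∨ (1 + δ) * R s ≤ ‖ξ j s - c s‖)) → ∀ μ : Fin 4, |P t₂ (c t₂) (R t₂)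 μ - P t₁ (c t₁) (R t₁) μ| ≤ C * (∫ s in t₁..t₂, ((R s) ^ 2)⁻¹ + ((R s) ^ (7 / 4 : ℝ))⁻¹) + η t₁)
    (hI : ∃ (C R₀ T : ℝ) (ζ : ℝ → ℝ), Tendsto ζ atTop (𝓝 0) ∧ (∀ (t : ℝ) (i : Fin N) (R : ℝ), T ≤ t → R₀ ≤ R → ‖ξ i t‖ + R ≤ (κ + κ ^ 2) / 2 * t → (∀ j, j ≠ i → 3 * R ≤ ‖ξ i t - ξ j t‖) → |P t (ξ i t) R 0 - M i * (√(1 - ‖v i t‖ ^ 2))⁻¹| ≤ ζ t + C / R ∧ ∀ k : Fin 3, |P t (ξ i t) R k.succ - M i * (√(1 - ‖v i t‖ ^ 2))⁻¹ * v i t k| ≤ ζ t + C / R) ∧ (∀ (t : ℝ) (c : E3) (R : ℝ) (A : Finset (Fin N)) (ρ : Fin N → ℝ), T ≤ t → R₀ ≤ R → ‖c‖ + R ≤ (κ + κ ^ 2) / 2 * t → (∀ j ∈ A, ‖ξ j t - c‖ ≤ R / 2) → (∀ j ∉ A, 2 * R ≤ ‖ξ j t - c‖) → (∀ j ∈ A,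 R₀ ≤ ρ j ∧ ρ j ≤ R / 4 ∧ ∀ j', j' ≠ j → 3 * ρ j ≤ ‖ξ j t - ξ j' t‖) → ∀ μ : Fin 4, |P t c R μ - ∑ j ∈ A, P t (ξ j t) (ρ j) μ| ≤ C * (R⁻¹ + ∑ j ∈ A, (ρ j)⁻¹) + ζ t))
    (i : Fin N) {R : ℝ → ℝ} {TR : ℝ}
    (hRlip : ∀ s s', TR ≤ s → TR ≤ s' → |R s - R s'| ≤ 2 * |s - s'|)
    (hRcone : ∀ s, TR ≤ s → R s ≤ (κ - κ ^ 2) / 2 * s)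
    (hRsep : ∀ s, TR ≤ s → ∀ j, j ≠ i → 3 * R s ≤ ‖ξ i s - ξ j s‖)
    (hRinf : Tendsto R atTop atTop) :
    ∃ (C T : ℝ) (e : ℝ → ℝ), 0 ≤ C ∧ Tendsto e atTop (𝓝 0) ∧ (∀ t, T ≤ t → 0 ≤ e t) ∧
      (∀ t₁ t₂, T ≤ t₁ → t₁ ≤ t₂ → ∀ μ : Fin 4,
        |P t₂ (ξ i t₂) (R t₂) μ - P t₁ (ξ i t₁) (R t₁) μ| ≤
          C * (∫ s in t₁..t₂, ((R s) ^ 2)⁻¹ + ((R s) ^ (7 / 4 : ℝ))⁻¹) + e t₁) ∧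
      (∀ t, T ≤ t → |P t (ξ i t) (R t) 0 - M i * (√(1 - ‖v i t‖ ^ 2))⁻¹| ≤ e t ∧
        ∀ k' : Fin 3, |P t (ξ i t) (R t) k'.succ - M i * (√(1 - ‖v i t‖ ^ 2))⁻¹ * v i t k'| ≤ e t) ∧
      (∀ t, T ≤ t → 1 ≤ R t ∧ TR ≤ t) := by
  obtain ⟨C, R₀, T, η, hη, hlaw⟩ := hW (1 / 2) (by norm_num) (by norm_num)
  obtain ⟨C', R₀', T', ζ, hζ, hid, -⟩ := hI
  obtain ⟨k, hk0, hk1, hvk⟩ := hk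
  have hκκ : 0 < κ - κ ^ 2 := by nlinarith
  -- differentiability and the eventual `2`-Lipschitz bound of `ξ i`
  have hdiff : Differentiable ℝ (ξ i) := (contDiff_infty_iff_deriv.mp (hξ i)).1
  obtain ⟨TL, hTL⟩ := exists_forall_norm_sub_le_two_mul hdiff (hslave i) hk1.le (hvk i)
  -- one late threshold
  have hR₀ : ∀ᶠ t in atTop, max (max R₀ R₀') 1 ≤ R t := hRinf.eventually_ge_atTop _
  obtain ⟨T₀, hT₀⟩ := eventually_atTop.mp ((hcone i).and (hR₀.and ((eventually_ge_atTop T).and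
    ((eventually_ge_atTop T').and ((eventually_ge_atTop TL).and ((eventually_ge_atTop TR).and
      (eventually_ge_atTop (0 : ℝ))))))))
  -- the error function
  refine ⟨|C|, T₀, fun t ↦ |η t| + (|ζ t| + |C'| / R t), abs_nonneg C, ?_, ?_, ?_, ?_, ?_⟩
  · -- `e → 0`
    have h1 : Tendsto (fun t ↦ |η t|) atTop (𝓝 0) := by simpa using hη.abs
    have h2 : Tendsto (fun t ↦ |ζ t|) atTop (𝓝 0) := by simpa using hζ.abs
    have h3 : Tendsto (fun t ↦ |C'| / R t) atTop (𝓝 0) := by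
      have := (tendsto_inv_atTop_zero.comp hRinf).const_mul |C'|
      rw [mul_zero] at this
      exact this.congr fun t ↦ by simp [div_eq_mul_inv]
    simpa using h1.add (h2.add h3)
  · -- `0 ≤ e` after `T₀`
    intro t ht
    obtain ⟨-, hRt, -⟩ := hT₀ t ht
    have hR1 : 1 ≤ R t := (le_max_right _ _).trans hRt
    positivity
  · -- the law along the path
    intro t₁ t₂ ht₁ h12 μ
    obtain ⟨-, -, hT1, -, hTL1, hTR1, -⟩ := hT₀ t₁ ht₁
    have key := hlaw t₁ t₂ (fun s ↦ ξ i s) R hT1 h12 ?_ ?_ μ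
    · refine key.trans ?_
      have hnn : 0 ≤ ∫ s in t₁..t₂, (((R s) ^ 2)⁻¹ + ((R s) ^ (7 / 4 : ℝ))⁻¹) := by
        apply intervalIntegral.integral_nonneg h12
        intro s hs
        obtain ⟨-, hRs, -⟩ := hT₀ s (ht₁.trans hs.1)
        have : 0 < R s := by linarith [le_max_right (max R₀ R₀') (1 : ℝ)]
        positivity
      have hC : C * (∫ s in t₁..t₂, (((R s) ^ 2)⁻¹ + ((R s) ^ (7 / 4 : ℝ))⁻¹)) ≤
          |C| * ∫ s in t₁..t₂, (((R s) ^ 2)⁻¹ + ((R s) ^ (7 / 4 : ℝ))⁻¹) :=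
        mul_le_mul_of_nonneg_right (le_abs_self C) hnn
      have hηt : η t₁ ≤ |η t₁| + (|ζ t₁| + |C'| / R t₁) := by
        obtain ⟨-, hRt, -⟩ := hT₀ t₁ ht₁
        have hR1 : 1 ≤ R t₁ := (le_max_right _ _).trans hRt
        have : 0 ≤ |ζ t₁| + |C'| / R t₁ := by positivity
        linarith [le_abs_self (η t₁)]
      linarith
    · intro s hs s' hs'
      exact ⟨hTL s s' (hTL1.trans hs.1) (hTL1.trans hs'.1),
        hRlip s s' (hTR1.trans hs.1) (hTR1.trans hs'.1)⟩
    · intro s hs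
      obtain ⟨hcone_s, hRs, -, -, -, hTRs, hs0⟩ := hT₀ s (ht₁.trans hs.1)
      refine ⟨(le_max_left _ _).trans ((le_max_left _ _).trans hRs), ?_, fun j ↦ ?_⟩
      · have := hRcone s hTRs
        nlinarith
      · by_cases hj : j = i
        · left
          subst hj
          rw [sub_self, norm_zero]
          have : 0 ≤ R s := le_trans (by positivity) ((le_max_right _ _).trans hRs)
          positivity
        · right
          have h3 := hRsep s hTRs j hj
          have hR1 : 1 ≤ R s := (le_max_right _ _).trans hRs
          rw [norm_sub_rev]
          linarith
  · -- identification at each late time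
    intro t ht
    obtain ⟨hcone_t, hRt, -, hT't, -, hTRt, ht0⟩ := hT₀ t ht
    have hR1 : 1 ≤ R t := (le_max_right _ _).trans hRt
    have hRpos : 0 < R t := by linarith
    have hR₀'t : R₀' ≤ R t := (le_max_right _ _).trans ((le_max_left _ _).trans hRt)
    have hid' := hid t i (R t) hT't hR₀'t (by have := hRcone t hTRt; nlinarith) (hRsep t hTRt)
    have herr : ζ t + C' / R t ≤ |η t| + (|ζ t| + |C'| / R t) := by
      have h1 : C' / R t ≤ |C'| / R t := div_le_div_of_nonneg_right (le_abs_self C') hRpos.le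
      linarith [le_abs_self (ζ t), abs_nonneg (η t)]
    exact ⟨hid'.1.trans herr, fun k' ↦ (hid'.2 k').trans herr⟩
  · intro t ht
    obtain ⟨-, hRt, -, -, -, hTRt, -⟩ := hT₀ t ht
    exact ⟨(le_max_right _ _).trans hRt, hTRt⟩

end Singleton

/-! ## Pair kinematics: algebra of charge increments, the pair radius -/

section PairAlgebra

/-- `‖x‖ ≤ Σₖ |xₖ|` in `EuclideanSpace ℝ (Fin n)`. [folklore] -/
theorem norm_le_sum_abs_coord {n : ℕ} (x : EuclideanSpace ℝ (Fin n)) : ‖x‖ ≤ ∑ k, |x k| := by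
  rw [EuclideanSpace.norm_eq]
  have h : ∑ k, ‖x k‖ ^ 2 ≤ (∑ k, |x k|) ^ 2 := by
    calc ∑ k, ‖x k‖ ^ 2 = ∑ k, |x k| ^ 2 := by simp [Real.norm_eq_abs]
      _ ≤ (∑ k, |x k|) ^ 2 :=
        Finset.sum_sq_le_sq_sum_of_nonneg (fun k _ ↦ abs_nonneg (x k))
  calc √(∑ k, ‖x k‖ ^ 2) ≤ √((∑ k, |x k|) ^ 2) := Real.sqrt_le_sqrt h
    _ = ∑ k, |x k| := Real.sqrt_sq (Finset.sum_nonneg fun k _ ↦ abs_nonneg _)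

/-- **Velocity increments from four-momentum increments**: if `γ ≥ 1` and `‖v'‖ ≤ 1` then
`‖v − v'‖ ≤ ‖γ • v − γ' • v'‖ + |γ − γ'|`. [folklore] -/
theorem norm_sub_le_of_gamma {v v' : E3} {γ γ' : ℝ} (hγ : 1 ≤ γ) (hv' : ‖v'‖ ≤ 1) :
    ‖v - v'‖ ≤ ‖γ • v - γ' • v'‖ + |γ - γ'| := by
  have hγ0 : 0 < γ := one_pos.trans_le hγ
  have key : v - v' = γ⁻¹ • (γ • v - γ' • v') + (γ⁻¹ * (γ' - γ)) • v' := by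
    rw [smul_sub, smul_smul, smul_smul, inv_mul_cancel₀ hγ0.ne', one_smul, mul_sub,
      inv_mul_cancel₀ hγ0.ne', sub_smul, one_smul]
    abel
  rw [key]
  calc ‖γ⁻¹ • (γ • v - γ' • v') + (γ⁻¹ * (γ' - γ)) • v'‖
      ≤ ‖γ⁻¹ • (γ • v - γ' • v')‖ + ‖(γ⁻¹ * (γ' - γ)) • v'‖ := norm_add_le _ _
    _ = γ⁻¹ * ‖γ • v - γ' • v'‖ + γ⁻¹ * |γ' - γ| * ‖v'‖ := by
        rw [norm_smul, norm_smul, Real.norm_eq_abs, Real.norm_eq_abs, abs_mul,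
          abs_of_pos (inv_pos.mpr hγ0)]
    _ ≤ 1 * ‖γ • v - γ' • v'‖ + 1 * |γ' - γ| * 1 := by
        have hinv : γ⁻¹ ≤ 1 := inv_le_one_of_one_le₀ hγ
        gcongr
    _ = ‖γ • v - γ' • v'‖ + |γ - γ'| := by rw [abs_sub_comm]; ring

/-- `(min a b)^{-p} ≤ a^{-p} + b^{-p}` for positive `a, b` and `p ≥ 0` (as reciprocals of `rpow`).
[folklore] -/
theorem inv_min_rpow_le {a b : ℝ} (p : ℝ) (ha : 0 < a) (hb : 0 < b) :
    ((min a b) ^ p)⁻¹ ≤ (a ^ p)⁻¹ + (b ^ p)⁻¹ := by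
  rcases min_choice a b with h | h <;> rw [h]
  · exact le_add_of_nonneg_right (by positivity)
  · exact le_add_of_nonneg_left (by positivity)

/-- Square version: `((min a b)²)⁻¹ ≤ (a²)⁻¹ + (b²)⁻¹`. [folklore] -/
theorem inv_min_sq_le {a b : ℝ} (ha : 0 < a) (hb : 0 < b) :
    ((min a b) ^ 2)⁻¹ ≤ (a ^ 2)⁻¹ + (b ^ 2)⁻¹ := by
  rcases min_choice a b with h | h <;> rw [h]
  · exact le_add_of_nonneg_right (by positivity)
  · exact le_add_of_nonneg_left (by positivity)

/-- Monotonicity of `x ↦ (x^p)⁻¹` on positives. [folklore] -/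
theorem inv_rpow_le_inv_rpow {a b p : ℝ} (ha : 0 < a) (hab : a ≤ b) (hp : 0 ≤ p) :
    (b ^ p)⁻¹ ≤ (a ^ p)⁻¹ :=
  inv_anti₀ (Real.rpow_pos_of_pos ha _) (Real.rpow_le_rpow ha.le hab hp)

/-- The coordinate `φ = ⟪e, ξᵢ − ξⱼ⟫` of a relative position is differentiable with derivative
`⟪e, ξᵢ' − ξⱼ'⟫`. [folklore] -/
theorem hasDerivAt_inner_sub {ξ₁ ξ₂ : ℝ → E3} (h₁ : Differentiable ℝ ξ₁) (h₂ : Differentiable ℝ ξ₂)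
    (e : E3) (s : ℝ) :
    HasDerivAt (fun s ↦ @inner ℝ E3 _ e (ξ₁ s - ξ₂ s))
      (@inner ℝ E3 _ e (deriv ξ₁ s - deriv ξ₂ s)) s := by
  have hw : HasDerivAt (fun s ↦ ξ₁ s - ξ₂ s) (deriv ξ₁ s - deriv ξ₂ s) s :=
    (h₁ s).hasDerivAt.sub (h₂ s).hasDerivAt
  have hc : HasDerivAt (fun _ : ℝ ↦ e) 0 s := hasDerivAt_const s e
  have := hc.inner ℝ hw
  simpa using this

/-- `|⟪e, w⟫| ≤ ‖w‖` for a unit vector `e`. [folklore] -/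
theorem abs_inner_le_norm_of_unit {e w : E3} (he : ‖e‖ = 1) : |@inner ℝ E3 _ e w| ≤ ‖w‖ := by
  have := abs_real_inner_le_norm e w
  rwa [he, one_mul] at this

end PairAlgebra

/-! ## Budget domination by a finite family of radii -/

section BudgetSum

open MeasureTheory intervalIntegral

/-- Budget domination by a finite family of radii: if on `[a, b]` the radius `R ≥ 1` dominates, at
every point, at least one member `Rp p ≥ 1` of a finite family of continuous radii, then
`∫(R⁻² + R^{-7/4}) ≤ Σₚ ∫(Rp⁻² + Rp^{-7/4})`. [folklore] -/
theorem integral_budget_le_sum {ι : Type*} (S : Finset ι) {R : ℝ → ℝ} {Rp : ι → ℝ → ℝ} {a b : ℝ}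
    (hab : a ≤ b) (hR : ContinuousOn R (Set.Icc a b)) (hRp : ∀ p ∈ S, Continuous (Rp p))
    (hR1 : ∀ s ∈ Set.Icc a b, 1 ≤ R s) (hRp1 : ∀ p ∈ S, ∀ s, 1 ≤ Rp p s)
    (hex : ∀ s ∈ Set.Icc a b, ∃ p ∈ S, Rp p s ≤ R s) :
    ∫ s in a..b, (((R s) ^ 2)⁻¹ + ((R s) ^ (7 / 4 : ℝ))⁻¹) ≤
      ∑ p ∈ S, ∫ s in a..b, (((Rp p s) ^ 2)⁻¹ + ((Rp p s) ^ (7 / 4 : ℝ))⁻¹) := by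
  have hIp : ∀ p ∈ S, IntervalIntegrable
      (fun s ↦ ((Rp p s) ^ 2)⁻¹ + ((Rp p s) ^ (7 / 4 : ℝ))⁻¹) volume a b := by
    intro p hp
    have hc := hRp p hp
    have hpos : ∀ s, 0 < Rp p s := fun s ↦ one_pos.trans_le (hRp1 p hp s)
    refine Continuous.intervalIntegrable (Continuous.add ?_ ?_) _ _
    · exact (hc.pow 2).inv₀ fun s ↦ pow_ne_zero 2 (hpos s).ne'
    · exact (hc.rpow_const fun s ↦ Or.inr (by norm_num)).inv₀ fun s ↦
        (Real.rpow_pos_of_pos (hpos s) _).ne'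
  have hI1 : IntervalIntegrable (fun s ↦ ((R s) ^ 2)⁻¹ + ((R s) ^ (7 / 4 : ℝ))⁻¹) volume a b := by
    have hRc : ContinuousOn R (Set.uIcc a b) := by rwa [Set.uIcc_of_le hab]
    have hRpos : ∀ s ∈ Set.uIcc a b, 0 < R s := fun s hs ↦ by
      rw [Set.uIcc_of_le hab] at hs
      exact one_pos.trans_le (hR1 s hs)
    refine ContinuousOn.intervalIntegrable (ContinuousOn.add ?_ ?_)
    · exact (hRc.pow 2).inv₀ fun s hs ↦ pow_ne_zero 2 (hRpos s hs).ne'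
    · exact (hRc.rpow_const fun s hs ↦ Or.inr (by norm_num)).inv₀ fun s hs ↦
        (Real.rpow_pos_of_pos (hRpos s hs) _).ne'
  have hI2 : IntervalIntegrable
      (fun s ↦ ∑ p ∈ S, (((Rp p s) ^ 2)⁻¹ + ((Rp p s) ^ (7 / 4 : ℝ))⁻¹)) volume a b := by
    have := IntervalIntegrable.sum S hIp
    rwa [Finset.sum_fn] at this
  rw [← intervalIntegral.integral_finsetSum hIp]
  refine intervalIntegral.integral_mono_on hab hI1 hI2 fun s hs ↦ ?_
  obtain ⟨p, hp, hle⟩ := hex s hs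
  have hRps : 0 < Rp p s := one_pos.trans_le (hRp1 p hp s)
  have h1 : ((R s) ^ 2)⁻¹ ≤ ((Rp p s) ^ 2)⁻¹ := by
    apply inv_anti₀ (pow_pos hRps 2)
    exact pow_le_pow_left₀ hRps.le hle 2
  have h2 : ((R s) ^ (7 / 4 : ℝ))⁻¹ ≤ ((Rp p s) ^ (7 / 4 : ℝ))⁻¹ :=
    inv_rpow_le_inv_rpow hRps hle (by norm_num)
  calc ((R s) ^ 2)⁻¹ + ((R s) ^ (7 / 4 : ℝ))⁻¹ ≤ ((Rp p s) ^ 2)⁻¹ + ((Rp p s) ^ (7 / 4 : ℝ))⁻¹ :=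
        add_le_add h1 h2
    _ ≤ ∑ q ∈ S, (((Rp q s) ^ 2)⁻¹ + ((Rp q s) ^ (7 / 4 : ℝ))⁻¹) := by
        refine Finset.single_le_sum (f := fun q ↦ ((Rp q s) ^ 2)⁻¹ + ((Rp q s) ^ (7 / 4 : ℝ))⁻¹)
          (fun q hq ↦ ?_) hp
        have := one_pos.trans_le (hRp1 q hq s)
        positivity

end BudgetSum

end Summit.FinalStateConjecture.FinalStateConjecture.Theorems.ChargeKinematics

namespace Summit.FinalStateConjecture.FinalStateConjecture.Theorems

/-- REGISTERED STUB `singleton_law` of the crux item stmt-FinalStateConjecture-10166 (second line lead, line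
`old-light-leaves-the-cone`, S4 helper series): the registered one-line signature verbatim, discharged by
`ChargeKinematics.singleton_law`. [folklore] -/
theorem singleton_law : open Literature.Geometry.Lorentzian Filter Topology MeasureTheory intervalIntegral in ∀ {N : ℕ} {M : Fin N → ℝ} {ξ v : Fin N → ℝ → E3} {κ : ℝ} {P : ℝ → E3 → ℝ → Fin 4 → ℝ} (hκ0 : 0 < κ) (hκ1 : κ < 1) (hξ : ∀ i, ContDiff ℝ ((⊤ : ℕ∞) : WithTop ℕ∞) (ξ i)) (hcone : ∀ i, ∀ᶠ t in atTop, ‖ξ i t‖ ≤ κ ^ 2 * t) (hk : ∃ k : ℝ, 0 ≤ k ∧ k < 1 ∧ ∀ i, ∀ᶠ t in atTop, ‖v i t‖ ≤ k) (hslave : ∀ i, Tendsto (fun t ↦ deriv (ξ i) t - v i t) atTop (𝓝 0)) (hW : ∀ δ : ℝ, 0 < δ → δ < 1 → ∃ (C R₀ T : ℝ) (η : ℝ → ℝ), Tendsto η atTop (𝓝 0) ∧ ∀ (t₁ t₂ : ℝ) (c : ℝ → E3) (R : ℝ → ℝ), T ≤ t₁ → t₁ ≤ t₂ → (∀ s ∈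 Set.Icc t₁ t₂, ∀ s' ∈ Set.Icc t₁ t₂, ‖c s - c s'‖ ≤ 2 * |s - s'| ∧ |R s - R s'| ≤ 2 * |s - s'|) → (∀ s ∈ Set.Icc t₁ t₂, (R₀ ≤ R s ∧ ‖c s‖ + R s ≤ (κ + κ ^ 2) / 2 * s ∧ ∀ j, ‖ξ j s - c s‖ ≤ (1 - δ) * R s ∨ (1 + δ) * R s ≤ ‖ξ j s - c s‖)) → ∀ μ : Fin 4, |P t₂ (c t₂) (R t₂) μ - P t₁ (c t₁) (R t₁) μ| ≤ C * (∫ s in t₁..t₂, ((R s) ^ 2)⁻¹ + ((R s) ^ (7 / 4 : ℝ))⁻¹) + η t₁) (hI : ∃ (C R₀ T : ℝ) (ζ : ℝ → ℝ), Tendsto ζ atTop (𝓝 0) ∧ (∀ (t : ℝ) (i : Fin N) (R : ℝ), T ≤ t → R₀ ≤ R → ‖ξ i t‖ + R ≤ (κ + κ ^ 2) / 2 * t → (∀ j, j ≠ i → 3 * R ≤ ‖ξ i t - ξ j t‖) → |P t (ξ i t) R 0 - M i * (√(1 - ‖v i t‖ ^ 2))⁻¹| ≤ ζ t + C / R ∧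 ∀ k : Fin 3, |P t (ξ i t) R k.succ - M i * (√(1 - ‖v i t‖ ^ 2))⁻¹ * v i t k| ≤ ζ t + C / R) ∧ (∀ (t : ℝ) (c : E3) (R : ℝ) (A : Finset (Fin N)) (ρ : Fin N → ℝ), T ≤ t → R₀ ≤ R → ‖c‖ + R ≤ (κ + κ ^ 2) / 2 * t → (∀ j ∈ A, ‖ξ j t - c‖ ≤ R / 2) → (∀ j ∉ A, 2 * R ≤ ‖ξ j t - c‖) → (∀ j ∈ A, R₀ ≤ ρ j ∧ ρ j ≤ R / 4 ∧ ∀ j', j' ≠ j → 3 * ρ j ≤ ‖ξ j t - ξ j' t‖) → ∀ μ : Fin 4, |P t c R μ - ∑ j ∈ A, P t (ξ j t) (ρ j) μ| ≤ C * (R⁻¹ + ∑ j ∈ A, (ρ j)⁻¹) + ζ t)) (i : Fin N) {R : ℝ → ℝ} {TR : ℝ} (hRlip : ∀ s s', TR ≤ s → TR ≤ s' → |R s - R s'| ≤ 2 * |s - s'|) (hRcone : ∀ s, TR ≤ s → R s ≤ (κ - κ ^ 2) / 2 * s) (hRsep : ∀ s, TR ≤ s → ∀ j, j ≠ i → 3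 * R s ≤ ‖ξ i s - ξ j s‖) (hRinf : Tendsto R atTop atTop), ∃ (C T : ℝ) (e : ℝ → ℝ), 0 ≤ C ∧ Tendsto e atTop (𝓝 0) ∧ (∀ t, T ≤ t → 0 ≤ e t) ∧ (∀ t₁ t₂, T ≤ t₁ → t₁ ≤ t₂ → ∀ μ : Fin 4, |P t₂ (ξ i t₂) (R t₂) μ - P t₁ (ξ i t₁) (R t₁) μ| ≤ C * (∫ s in t₁..t₂, ((R s) ^ 2)⁻¹ + ((R s) ^ (7 / 4 : ℝ))⁻¹) + e t₁) ∧ (∀ t, T ≤ t → |P t (ξ i t) (R t) 0 - M i * (√(1 - ‖v i t‖ ^ 2))⁻¹| ≤ e t ∧ ∀ k' : Fin 3, |P t (ξ i t) (R t) k'.succ - M i * (√(1 - ‖v i t‖ ^ 2))⁻¹ * v i t k'| ≤ e t) ∧ (∀ t, T ≤ t → 1 ≤ R t ∧ TR ≤ t) :=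
  @ChargeKinematics.singleton_law

end Summit.FinalStateConjecture.FinalStateConjecture.Theorems

end
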